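import Mathlib.Geometry.Manifold.ChartedSpace
import Mathlib.Analysis.InnerProductSpace.PiL2
import Mathlib.Analysis.Normed.Module.Ball.Homeomorph
import Mathlib.Topology.UrysohnsLemma
import Mathlib.Topology.ShrinkingLemma
import Mathlib.Topology.Algebra.Module.FiniteDimension
import HarnessLib

/-!
# Compact subsets of a topological manifold have neighbourhoods that inject into Euclidean space

Topic `Literature/Geometry/Manifold`, companion of `TopologicalEmbedding.lean` (which embeds a
COMPACT manifold in `ℝᴺ`, Hatcher, *Algebraic Topology* (2002), proof of Cor. A.9). For a
noncompact (e.g. second countable, Hausdorff) topological manifold `M` the same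
partition-of-unity map, built from finitely many charts covering a compact subset `K`, is
continuous on all of `M` and injective on a compact neighbourhood `L` of `K` — which is all that
local constructions over compact pieces of `M` need (Milnor 1959, Cor. 1, via an exhaustion of
`M` by compact sets: `Literature/AlgebraicTopology/Homotopy/`). PROVED here, no named facts:

* `Literature.Geometry.Manifold.exists_continuous_injOn_nhds_of_isCompact`: for `K` compact
  inside an open `U` of a Hausdorff locally compact space with an atlas of charts into a real
  normed space `H`, there are a compact `L` with `K ⊆ interior L`, `L ⊆ U`, a finite set `t`
  of chart centres and a continuous `F : M → (t → H × ℝ)` injective on `L` (indeed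
  `F x = F y`, `x ∈ L` forces `x = y`).
* `Literature.Geometry.Manifold.exists_continuous_injOn_nhds_pi_of_isCompact`: the same with
  target `Fin N → ℝ` when `H` is finite dimensional.

## Proof

As in `TopologicalEmbedding.lean`: finitely many chart domains `Uᵢ` cover `K`; a compact
neighbourhood `L` of `K` inside `U ∩ ⋃ Uᵢ` (local compactness); a closed cover `Cᵢ ⊆ Uᵢ` of the
compact Hausdorff (hence normal) subspace `L` (shrinking lemma); Urysohn functions
`λᵢ : M → [0, 1]`, `= 1` on `Cᵢ`, `= 0` off `Uᵢ` (`exists_continuous_zero_one_of_isCompact`);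
`F(x) = (λᵢ(x) • φᵢ(x), λᵢ(x))ᵢ` with `φᵢ` the chart made bounded by `H ≃ ball 0 1` and
extended by `0`. If `x ∈ Cᵢ` and `F x = F y` then `λᵢ(y) = 1`, so `y ∈ Uᵢ` and `φᵢ x = φᵢ y`.

## References

* A. Hatcher, *Algebraic Topology*, CUP (2002), Appendix, proof of Cor. A.9 (p. 527).
  [HatcherAT2002]
-/

noncomputable section

open Set Function Filter Topology

namespace Literature.Geometry.Manifold

section Embedding

variable {M : Type*} [TopologicalSpace M] [T2Space M] [LocallyCompactSpace M]

/-- **A compact subset of a manifold has a compact neighbourhood that injects continuously into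
a finite product `t → H × ℝ`** by a map defined and continuous on the whole manifold (Hatcher
2002, proof of Cor. A.9, localised): given `K` compact in an open `U`, there are a compact `L`,
`K ⊆ interior L ⊆ L ⊆ U`, finitely many chart centres `t` and a continuous `F : M → (t → H × ℝ)`
with `F x = F y → x = y` whenever `x ∈ L`. [cite: HatcherAT2002, proof of Cor. A.9] -/
theorem exists_continuous_injOn_nhds_of_isCompact (H : Type*) [NormedAddCommGroup H]
    [NormedSpace ℝ H] [ChartedSpace H M] {K U : Set M} (hK : IsCompact K) (hU : IsOpen U)
    (hKU : K ⊆ U) :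
    ∃ (L : Set M) (t : Finset M) (F : M → (↥t → H × ℝ)), IsCompact L ∧ K ⊆ interior L ∧ L ⊆ U ∧
      Continuous F ∧ ∀ x ∈ L, ∀ y, F x = F y → x = y := by
  classical
  -- finitely many chart domains cover `K`
  obtain ⟨t, ht⟩ : ∃ t : Finset M, K ⊆ ⋃ p ∈ t, (chartAt H p).source :=
    hK.elim_finite_subcover (fun p : M => (chartAt H p).source)
      (fun p => (chartAt H p).open_source) (fun p _ => mem_iUnion.2 ⟨p, mem_chart_source H p⟩)
  set u : ↥t → Set M := fun i => (chartAt H (i : M)).source with hu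
  have huo : ∀ i, IsOpen (u i) := fun i => (chartAt H (i : M)).open_source
  have hKu : K ⊆ ⋃ i, u i := by
    intro x hx
    obtain ⟨p, hp, hx⟩ := mem_iUnion₂.1 (ht hx)
    exact mem_iUnion.2 ⟨⟨p, hp⟩, hx⟩
  -- a compact neighbourhood `L` of `K` inside `U ∩ ⋃ uᵢ`
  obtain ⟨L, hLc, hKL, hLO⟩ := exists_compact_between hK (hU.inter (isOpen_iUnion huo))
    (subset_inter hKU hKu)
  have hLU : L ⊆ U := fun x hx => (hLO hx).1
  have hLu : L ⊆ ⋃ i, u i := fun x hx => (hLO hx).2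
  -- a closed cover `Cᵢ ⊆ uᵢ` of `L` (shrinking lemma in the compact Hausdorff space `L`)
  haveI : CompactSpace L := isCompact_iff_compactSpace.1 hLc
  obtain ⟨v, hvcov, hvc, hvu⟩ := exists_iUnion_eq_closed_subset (X := L)
    (u := fun i => Subtype.val ⁻¹' u i) (fun i => (huo i).preimage continuous_subtype_val)
    (fun x => Set.toFinite _)
    (by
      refine univ_subset_iff.1 fun x _ => ?_
      obtain ⟨i, hi⟩ := mem_iUnion.1 (hLu x.2)
      exact mem_iUnion.2 ⟨i, hi⟩)
  set C : ↥t → Set M := fun i => Subtype.val '' v i with hC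
  have hCc : ∀ i, IsCompact (C i) := fun i => ((hvc i).isCompact).image continuous_subtype_val
  have hCu : ∀ i, C i ⊆ u i := by
    rintro i _ ⟨x, hx, rfl⟩; exact hvu i hx
  have hLC : ∀ x ∈ L, ∃ i, x ∈ C i := by
    intro x hx
    have : (⟨x, hx⟩ : L) ∈ ⋃ i, v i := by rw [hvcov]; exact mem_univ _
    obtain ⟨i, hi⟩ := mem_iUnion.1 this
    exact ⟨i, ⟨x, hx⟩, hi, rfl⟩
  -- Urysohn functions: `= 1` on `Cᵢ`, `= 0` off `uᵢ`
  have hlam : ∀ i, ∃ g : C(M, ℝ), EqOn g 1 (C i) ∧ EqOn g 0 (u i)ᶜ ∧ ∀ x, g x ∈ Icc (0 : ℝ) 1 := by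
    intro i
    obtain ⟨g, hg0, hg1, hg01⟩ := exists_continuous_zero_one_of_isCompact (hCc i)
      (huo i).isClosed_compl (disjoint_compl_right_iff_subset.2 (hCu i))
    refine ⟨1 - g, fun x hx => ?_, fun x hx => ?_, fun x => ?_⟩
    · simp [hg0 hx]
    · simp [hg1 hx]
    · have := hg01 x
      simp only [ContinuousMap.sub_apply, ContinuousMap.one_apply, mem_Icc] at this ⊢
      constructor <;> linarith [this.1, this.2]
  choose lam hlam1 hlam0 hlam01 using hlam
  -- bounded charts, extended by `0`
  set φ : ↥t → M → H := fun i x =>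
    if x ∈ u i then OpenPartialHomeomorph.univUnitBall (chartAt H (i : M) x) else 0 with hφ
  have hφmem : ∀ i x, x ∈ u i → φ i x = OpenPartialHomeomorph.univUnitBall (chartAt H (i : M) x) :=
    fun i x hx => by simp [hφ, hx]
  have hφnot : ∀ i x, x ∉ u i → φ i x = 0 := fun i x hx => by simp [hφ, hx]
  have hφnorm : ∀ i x, ‖φ i x‖ ≤ 1 := by
    intro i x
    by_cases hx : x ∈ u i
    · rw [hφmem i x hx]
      have h := OpenPartialHomeomorph.univUnitBall.map_source (x := chartAt H (i : M) x)
        (mem_univ _)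
      rw [OpenPartialHomeomorph.univUnitBall_target, mem_ball_zero_iff] at h
      exact h.le
    · rw [hφnot i x hx, norm_zero]
      exact zero_le_one
  have hφcont : ∀ i, ContinuousOn (φ i) (u i) := by
    intro i
    have h1 : Continuous (OpenPartialHomeomorph.univUnitBall : H → H) :=
      continuousOn_univ.1 (OpenPartialHomeomorph.univUnitBall (E := H)).continuousOn
    refine (h1.comp_continuousOn (chartAt H (i : M)).continuousOn).congr ?_
    intro x hx
    simp [hφmem i x hx]
  have hφinj : ∀ i, InjOn (φ i) (u i) := by
    intro i x hx y hy hxy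
    rw [hφmem i x hx, hφmem i y hy] at hxy
    have h1 : chartAt H (i : M) x = chartAt H (i : M) y :=
      (OpenPartialHomeomorph.univUnitBall (E := H)).injOn (mem_univ _) (mem_univ _) hxy
    exact (chartAt H (i : M)).injOn hx hy h1
  -- the map
  refine ⟨L, t, fun x i => (lam i x • φ i x, lam i x), hLc, hKL, hLU, ?_, ?_⟩
  · -- continuity
    refine continuous_pi fun i => Continuous.prodMk ?_ (lam i).continuous
    refine continuous_iff_continuousAt.2 fun x => ?_
    by_cases hx : x ∈ u i
    · have hon : ContinuousOn (fun y => lam i y • φ i y) (u i) :=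
        (lam i).continuous.continuousOn.smul (hφcont i)
      exact hon.continuousAt ((huo i).mem_nhds hx)
    · have h0 : lam i x = 0 := hlam0 i hx
      rw [ContinuousAt, h0, zero_smul]
      refine tendsto_zero_iff_norm_tendsto_zero.2
        (squeeze_zero (g := fun y => ‖lam i y‖) (fun y => norm_nonneg _) (fun y => ?_) ?_)
      · rw [norm_smul]
        exact mul_le_of_le_one_right (norm_nonneg _) (hφnorm i y)
      · have h := ((lam i).continuous.tendsto x).norm
        rwa [h0, norm_zero] at h
  · -- injectivity at points of `L`
    intro x hxL y hxy
    obtain ⟨i, hi⟩ := hLC x hxL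
    have h := congr_fun hxy i
    simp only [Prod.mk.injEq] at h
    have hx1 : lam i x = 1 := hlam1 i hi
    have hy1 : lam i y = 1 := by rw [← h.2, hx1]
    have hyu : y ∈ u i := by
      by_contra hyu
      have := hlam0 i hyu
      simp only [Pi.zero_apply] at this
      rw [this] at hy1
      exact zero_ne_one hy1
    have hb : φ i x = φ i y := by
      have h1 := h.1
      rwa [hx1, hy1, one_smul, one_smul] at h1
    exact hφinj i (hCu i hi) hyu hb

/-- **A compact subset of an `n`-manifold has a compact neighbourhood that injects continuously
into `ℝᴺ`** (`Fin N → ℝ`, sup norm; the finite product `t → H × ℝ` of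
`exists_continuous_injOn_nhds_of_isCompact` composed with a linear homeomorphism, `H` finite
dimensional). [cite: HatcherAT2002, proof of Cor. A.9] -/
theorem exists_continuous_injOn_nhds_pi_of_isCompact (H : Type*) [NormedAddCommGroup H]
    [NormedSpace ℝ H] [FiniteDimensional ℝ H] [ChartedSpace H M] {K U : Set M}
    (hK : IsCompact K) (hU : IsOpen U) (hKU : K ⊆ U) :
    ∃ (L : Set M) (N : ℕ) (F : M → (Fin N → ℝ)), IsCompact L ∧ K ⊆ interior L ∧ L ⊆ U ∧
      Continuous F ∧ ∀ x ∈ L, ∀ y, F x = F y → x = y := by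
  obtain ⟨L, t, F, hLc, hKL, hLU, hFc, hFi⟩ :=
    exists_continuous_injOn_nhds_of_isCompact (M := M) H hK hU hKU
  set N := Module.finrank ℝ (↥t → H × ℝ) with hN
  have e : (↥t → H × ℝ) ≃L[ℝ] (Fin N → ℝ) :=
    ContinuousLinearEquiv.ofFinrankEq (by rw [Module.finrank_fin_fun])
  exact ⟨L, N, e ∘ F, hLc, hKL, hLU, e.continuous.comp hFc,
    fun x hx y hxy => hFi x hx y (e.injective hxy)⟩

end Embedding

end Literature.Geometry.Manifold

end
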